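import Mathlib.Analysis.InnerProductSpace.LinearMap
import Literature.AlgebraicTopology.CharacteristicClasses.ProjectiveBundleSplitting
import Literature.AlgebraicTopology.CharacteristicClasses.GaussMap
import Literature.AlgebraicTopology.CharacteristicClasses.FibrewiseContinuity
import Literature.AlgebraicTopology.CharacteristicClasses.FibreBundleParacompact
import HarnessLib

/-!
# The splitting `q*ξ ≅ λ_ξ ⊕ σ_ξ` over the projective bundle: the isomorphism

Topic `Literature/AlgebraicTopology/CharacteristicClasses`. D. Husemoller, *Fibre Bundles*, Ch. 17
§5 Prop. 5.2 (the splitting map of Thm. 5.4): for the projective bundle `q : E(Pξ) → B` of a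
complex vector bundle `ξ` over a paracompact base, `q*(ξ) = λ_ξ ⊕ σ_ξ` with `λ_ξ` the line
subbundle and `σ_ξ` a complement ("using a Hermitian metric, let `σ_ξ` be the orthogonal
complement"). With the cores `lineCore`, `quotCore` of `ProjectiveBundleSplitting.lean` and a
Gauss map `g : E → H` into an inner product space (which exists over paracompact Hausdorff bases,
`exists_gaussMap`; the metric is `⟨v, w⟩ = ⟨g v, g w⟩`) we build the isomorphism of the tree's
`ComplexVectorBundle`s

  `splitIso g : (E.pullback q).Iso (lineBundle ⊕ quotBundle)`,

fibrewise `w ↦ (s(w), x_α(w) - φ₀(x_α(w)) v_α)` in an adapted chart `α` at the point, where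
`s(w) = ⟨g u, g w⟩ / ⟨g u, g u⟩` is the coefficient of the orthogonal projection onto the line
`ℂ u` (`lineCoeff`), and prove the **existence of splitting data**
(`exists_splitting`): a paracompact Hausdorff `B₁ = P(E)`, `f = q`, `L = λ` of rank `1`, `E' = σ`
of rank `rank E - 1`, and `f*E ≅ L ⊕ E'` — the point-set half of Husemoller's Prop. 5.2 (the
cohomological half, injectivity of `q*`, is the Leray–Hirsch theorem).

Everything is proved; no named facts.

## References

* [HusemollerFibreBundles1994] D. Husemoller, *Fibre Bundles*, 3rd ed., GTM 20 (1994), Ch. 17 §5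
  Prop. 5.2, Thm. 5.4; Ch. 3 §5 (Gauss maps), §9 (metrics).
-/

noncomputable section

open Bundle Function Set Filter Topology
open scoped LinearAlgebra.Projectivization InnerProductSpace

namespace Literature.AlgebraicTopology.CharacteristicClasses

namespace ComplexVectorBundle

variable {B : Type} [TopologicalSpace B] (E : ComplexVectorBundle.{0, 0} B) (k₀ : Fin E.rank)
  {H : Type} [NormedAddCommGroup H] [InnerProductSpace ℂ H] (g : GaussMap ℂ E.F E.E H)

/-! ### The Gauss map on a fibre and the coefficient of the orthogonal projection onto a line -/

/-- The Gauss map on the fibre over `b`, a continuous linear map `E_b → H`. [cite: HusemollerFibreBundles1994, Ch. 3 §5 Def. 5.1] -/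
def gaussAt (b : B) : E.E b →L[ℂ] H where
  toLinearMap := g.fiberMap b
  cont := by
    have h : Continuous fun w : E.E b ↦ g.toFun ⟨b, w⟩ :=
      g.continuous.comp (FiberBundle.continuous_totalSpaceMk E.F E.E b)
    exact h.congr fun w ↦ g.apply_mk b w

/-- The fibre Gauss map is the Gauss map. [folklore] -/
@[simp]
theorem gaussAt_apply (b : B) (w : E.E b) : E.gaussAt g b w = g.toFun ⟨b, w⟩ := (g.apply_mk b w).symm

/-- The fibre Gauss map does not vanish on nonzero vectors. [folklore] -/
theorem gaussAt_ne_zero {b : B} {w : E.E b} (hw : w ≠ 0) : E.gaussAt g b w ≠ 0 := by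
  rw [gaussAt_apply]
  exact g.apply_ne_zero hw

/-- The vector `u_α(m) = T_α⁻¹ v_α(m) ∈ E_{q m}` spanning the line `m`, adapted to the chart `α`.
[folklore] -/
def lineVecIn (α : E.FrameIndex) (m : E.Proj) : E.E m.proj :=
  (E.adaptedFrame α m.proj).symm (E.lineRep k₀ α m)

/-- **The coefficient of the orthogonal projection onto the line** `ℂ u_α(m)` for the metric
`⟨v, w⟩ = ⟨g v, g w⟩`: `s(w) = ⟨g u, g w⟩ / ⟨g u, g u⟩`, a continuous linear functional on the
fibre. [cite: HusemollerFibreBundles1994, Ch. 17 §5 Prop. 5.2] -/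
def lineCoeff (α : E.FrameIndex) (m : E.Proj) : E.E m.proj →L[ℂ] ℂ :=
  (⟪E.gaussAt g m.proj (E.lineVecIn k₀ α m), E.gaussAt g m.proj (E.lineVecIn k₀ α m)⟫_ℂ)⁻¹ •
    (innerSL ℂ (E.gaussAt g m.proj (E.lineVecIn k₀ α m))).comp (E.gaussAt g m.proj)

/-- The coefficient, unfolded. [folklore] -/
theorem lineCoeff_apply (α : E.FrameIndex) (m : E.Proj) (w : E.E m.proj) :
    E.lineCoeff k₀ g α m w =
      (⟪E.gaussAt g m.proj (E.lineVecIn k₀ α m), E.gaussAt g m.proj (E.lineVecIn k₀ α m)⟫_ℂ)⁻¹ *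
        ⟪E.gaussAt g m.proj (E.lineVecIn k₀ α m), E.gaussAt g m.proj w⟫_ℂ := by
  simp [lineCoeff]

variable {E k₀}

/-- The spanning vector is nonzero on the chart. [folklore] -/
theorem lineVecIn_ne_zero {α : E.FrameIndex} {m : E.Proj} (hm : m ∈ E.chartSet k₀ α) :
    E.lineVecIn k₀ α m ≠ 0 := by
  rw [lineVecIn]
  exact (E.adaptedFrame α m.proj).symm.injective.ne_iff' (map_zero _) |>.2 (lineRep_ne_zero hm)

/-- In the frame `α` the spanning vector has coordinates `v_α`. [folklore] -/
theorem adaptedFrame_lineVecIn (α : E.FrameIndex) (m : E.Proj) :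
    E.adaptedFrame α m.proj (E.lineVecIn k₀ α m) = E.lineRep k₀ α m :=
  ContinuousLinearEquiv.apply_symm_apply _ _

/-- `s(u) = 1`. [folklore] -/
theorem lineCoeff_lineVecIn {α : E.FrameIndex} {m : E.Proj} (hm : m ∈ E.chartSet k₀ α) :
    E.lineCoeff k₀ g α m (E.lineVecIn k₀ α m) = 1 := by
  rw [lineCoeff_apply, inv_mul_cancel₀]
  exact inner_self_ne_zero.2 (gaussAt_ne_zero E g (lineVecIn_ne_zero hm))

/-- Change of chart for the spanning vectors: `u_α = c_{αβ} u_β`. [folklore] -/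
theorem lineVecIn_eq_smul {α β : E.FrameIndex} {m : E.Proj} (hα : m ∈ E.chartSet k₀ α)
    (hβ : m ∈ E.chartSet k₀ β) :
    E.lineVecIn k₀ α m = E.transScalar k₀ α β m • E.lineVecIn k₀ β m := by
  apply (E.adaptedFrame β m.proj).injective
  rw [map_smul, adaptedFrame_lineVecIn, lineVecIn, adaptedFrame_symm_apply ⟨hα.1, hβ.1⟩,
    (frameChange_lineRep hα hβ).2]

/-- Change of chart for the coefficient: `s_β = c_{αβ} s_α`. [folklore] -/
theorem lineCoeff_eq_smul {α β : E.FrameIndex} {m : E.Proj} (hα : m ∈ E.chartSet k₀ α)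
    (hβ : m ∈ E.chartSet k₀ β) (w : E.E m.proj) :
    E.lineCoeff k₀ g β m w = E.transScalar k₀ α β m * E.lineCoeff k₀ g α m w := by
  have hc := (frameChange_lineRep hα hβ).1
  set c := E.transScalar k₀ α β m with hc_def
  have hu : E.lineVecIn k₀ α m = c • E.lineVecIn k₀ β m := lineVecIn_eq_smul hα hβ
  have hne : ⟪E.gaussAt g m.proj (E.lineVecIn k₀ β m), E.gaussAt g m.proj (E.lineVecIn k₀ β m)⟫_ℂ ≠ 0 :=
    inner_self_ne_zero.2 (gaussAt_ne_zero E g (lineVecIn_ne_zero hβ))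
  rw [lineCoeff_apply, lineCoeff_apply, hu, map_smul, inner_smul_left, inner_smul_left,
    inner_smul_right]
  have hcc : (starRingEnd ℂ) c ≠ 0 := (map_ne_zero _).2 hc
  field_simp

/-! ### The fibrewise splitting maps in a chart -/

variable (E k₀)

/-- **The forward splitting map in the chart `α`**: `w ↦ (s(w), x - φ₀(x) v_α)` with `x = T_α w`
the coordinates of `w` in the frame `α`. [cite: HusemollerFibreBundles1994, Ch. 17 §5 Prop. 5.2] -/
def splitFwd (α : E.FrameIndex) (m : E.Proj) : E.E m.proj →L[ℂ] ℂ × E.quotModel k₀ :=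
  (E.lineCoeff k₀ g α m).prod
    ((E.projAlong k₀ (E.lineRep k₀ α m)).comp (E.adaptedFrame α m.proj : E.E m.proj →L[ℂ] E.F))

/-- **The backward splitting map in the chart `α`**: `(c, y) ↦ T_α⁻¹ ((c - s(T_α⁻¹ y)) v_α + y)`.
[cite: HusemollerFibreBundles1994, Ch. 17 §5 Prop. 5.2] -/
def splitBwd (α : E.FrameIndex) (m : E.Proj) : ℂ × E.quotModel k₀ →L[ℂ] E.E m.proj :=
  ((E.adaptedFrame α m.proj).symm : E.F →L[ℂ] E.E m.proj).comp
    ((ContinuousLinearMap.fst ℂ ℂ (E.quotModel k₀) -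
        (E.lineCoeff k₀ g α m).comp
          (((E.adaptedFrame α m.proj).symm : E.F →L[ℂ] E.E m.proj).comp
            ((E.quotModel k₀).subtypeL.comp (ContinuousLinearMap.snd ℂ ℂ (E.quotModel k₀))))).smulRight
        (E.lineRep k₀ α m) +
      (E.quotModel k₀).subtypeL.comp (ContinuousLinearMap.snd ℂ ℂ (E.quotModel k₀)))

variable {E k₀}

/-- The forward map, unfolded. [folklore] -/
theorem splitFwd_apply (α : E.FrameIndex) (m : E.Proj) (w : E.E m.proj) :
    E.splitFwd k₀ g α m w =
      (E.lineCoeff k₀ g α m w, E.projAlong k₀ (E.lineRep k₀ α m) (E.adaptedFrame α m.proj w)) := rfl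

/-- The backward map, unfolded. [folklore] -/
theorem splitBwd_apply (α : E.FrameIndex) (m : E.Proj) (c : ℂ) (y : E.quotModel k₀) :
    E.splitBwd k₀ g α m (c, y) = (E.adaptedFrame α m.proj).symm
      ((c - E.lineCoeff k₀ g α m ((E.adaptedFrame α m.proj).symm y)) • E.lineRep k₀ α m + y) := rfl

/-- `Ψ ∘ Φ = 1` on the chart. [folklore] -/
theorem splitBwd_splitFwd {α : E.FrameIndex} {m : E.Proj} (hm : m ∈ E.chartSet k₀ α)
    (w : E.E m.proj) : E.splitBwd k₀ g α m (E.splitFwd k₀ g α m w) = w := by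
  rw [splitFwd_apply, splitBwd_apply]
  apply (E.adaptedFrame α m.proj).injective
  rw [ContinuousLinearEquiv.apply_symm_apply, projAlong_apply (hv := φ₀_lineRep hm), map_sub,
    map_smul, ContinuousLinearEquiv.symm_apply_apply, map_sub, map_smul,
    ← lineVecIn, lineCoeff_lineVecIn g hm]
  simp only [smul_eq_mul, mul_one, sub_sub_cancel]
  abel

/-- `Φ ∘ Ψ = 1` on the chart. [folklore] -/
theorem splitFwd_splitBwd {α : E.FrameIndex} {m : E.Proj} (hm : m ∈ E.chartSet k₀ α)
    (z : ℂ × E.quotModel k₀) : E.splitFwd k₀ g α m (E.splitBwd k₀ g α m z) = z := by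
  obtain ⟨c, y⟩ := z
  have hy : E.coordFun k₀ (y : E.F) = 0 := y.2
  refine Prod.ext ?_ ?_
  · change E.lineCoeff k₀ g α m ((E.adaptedFrame α m.proj).symm
      ((c - E.lineCoeff k₀ g α m ((E.adaptedFrame α m.proj).symm y)) • E.lineRep k₀ α m + y)) = c
    rw [map_add, map_smul, ← lineVecIn, map_add, map_smul, lineCoeff_lineVecIn g hm, smul_eq_mul,
      mul_one, sub_add_cancel]
  · apply Subtype.ext
    change ((E.projAlong k₀ (E.lineRep k₀ α m)) ((E.adaptedFrame α m.proj) ((E.adaptedFrame α m.proj).symm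
      ((c - E.lineCoeff k₀ g α m ((E.adaptedFrame α m.proj).symm y)) • E.lineRep k₀ α m + y))) : E.F) = y
    rw [ContinuousLinearEquiv.apply_symm_apply, projAlong_apply (hv := φ₀_lineRep hm), map_add,
      map_smul, φ₀_lineRep hm, hy, smul_eq_mul, mul_one, add_zero, add_sub_cancel_left]

/-- **The splitting isomorphism of the fibre in the chart `α`**, `E_{q m} ≃L ℂ × ker φ₀`.
[cite: HusemollerFibreBundles1994, Ch. 17 §5 Prop. 5.2] -/
def splitEquiv {α : E.FrameIndex} {m : E.Proj} (hm : m ∈ E.chartSet k₀ α) :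
    E.E m.proj ≃L[ℂ] ℂ × E.quotModel k₀ :=
  ContinuousLinearEquiv.equivOfInverse (E.splitFwd k₀ g α m) (E.splitBwd k₀ g α m)
    (splitBwd_splitFwd g hm) (splitFwd_splitBwd g hm)

/-- The splitting equivalence acts as the forward map. [folklore] -/
@[simp]
theorem splitEquiv_apply {α : E.FrameIndex} {m : E.Proj} (hm : m ∈ E.chartSet k₀ α) (w : E.E m.proj) :
    splitEquiv g hm w = E.splitFwd k₀ g α m w := rfl

/-- Its inverse acts as the backward map. [folklore] -/
@[simp]
theorem splitEquiv_symm_apply {α : E.FrameIndex} {m : E.Proj} (hm : m ∈ E.chartSet k₀ α)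
    (z : ℂ × E.quotModel k₀) : (splitEquiv g hm).symm z = E.splitBwd k₀ g α m z := rfl

/-! ### Covariance under change of chart -/

/-- **The forward map is compatible with the cocycles of `λ ⊕ σ`**: reading `Φ_α` in the chart
`β` through the transition functions gives `Φ_β`. [folklore] -/
theorem coordChange_splitFwd {α β : E.FrameIndex} {m : E.Proj} (hα : m ∈ E.chartSet k₀ α)
    (hβ : m ∈ E.chartSet k₀ β) (w : E.E m.proj) :
    ((E.lineCore k₀).coordChange α β m (E.splitFwd k₀ g α m w).1,
      (E.quotCore k₀).coordChange α β m (E.splitFwd k₀ g α m w).2) = E.splitFwd k₀ g β m w := by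
  rw [splitFwd_apply, splitFwd_apply]
  refine Prod.ext ?_ ?_
  · rw [lineCore_coordChange_apply, lineCoeff_eq_smul g hα hβ]
  · change E.quotCoordChange k₀ α β m _ = _
    apply Subtype.ext
    rw [quotCoordChange_apply (hβ := hβ), projAlong_apply (hv := φ₀_lineRep hα),
      projAlong_apply (hv := φ₀_lineRep hβ), map_sub, map_smul, (frameChange_lineRep hα hβ).2,
      ← adaptedFrame_symm_apply ⟨hα.1, hβ.1⟩, ContinuousLinearEquiv.symm_apply_apply, map_sub,
      map_smul, map_smul, φ₀_lineRep hβ]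
    simp only [smul_eq_mul, mul_one, smul_smul, sub_smul]
    abel

/-- The backward map is compatible with the cocycles as well. [folklore] -/
theorem splitBwd_coordChange {α β : E.FrameIndex} {m : E.Proj} (hα : m ∈ E.chartSet k₀ α)
    (hβ : m ∈ E.chartSet k₀ β) (z : ℂ × E.quotModel k₀) :
    E.splitBwd k₀ g β m ((E.lineCore k₀).coordChange α β m z.1, (E.quotCore k₀).coordChange α β m z.2) =
      E.splitBwd k₀ g α m z := by
  have h := coordChange_splitFwd g hα hβ (E.splitBwd k₀ g α m z)
  rw [splitFwd_splitBwd g hα] at h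
  rw [h, splitBwd_splitFwd g hβ]

/-! ### Continuity in charts -/

/-- In the frame `α = (i, A)`, the coordinates of `e_i⁻¹(b) x` are `A x`. [folklore] -/
theorem adaptedFrame_symm_triv {α : E.FrameIndex} {b : B} (hb : b ∈ (E.triv α.1).baseSet) (x : E.F) :
    E.adaptedFrame α b ((E.triv α.1).symm b x) = α.2 x := by
  simp only [adaptedFrame, ContinuousLinearEquiv.trans_apply]
  rw [linEquivAt_apply _ hb, Trivialization.apply_mk_symm _ hb]

/-- In the frame `α = (i, A)`, `T_α⁻¹ z = e_i⁻¹(b) (A⁻¹ z)`. [folklore] -/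
theorem adaptedFrame_symm_eq_triv_symm {α : E.FrameIndex} {b : B} (hb : b ∈ (E.triv α.1).baseSet)
    (z : E.F) : (E.adaptedFrame α b).symm z = (E.triv α.1).symm b (α.2.symm z) := by
  simp only [adaptedFrame, ContinuousLinearEquiv.symm_trans_apply]
  rw [linEquivAt_symm_apply _ hb]

/-- `e_i⁻¹(b)` is injective on the base set: `e_i⁻¹(b) z = 0 → z = 0`. [folklore] -/
theorem triv_symm_eq_zero {i b : B} (hb : b ∈ (E.triv i).baseSet) {z : E.F}
    (hz : (E.triv i).symm b z = 0) : z = 0 := by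
  have h := (E.triv i).apply_mk_symm hb z
  rw [hz] at h
  have h0 : ((E.triv i) ⟨b, (0 : E.E b)⟩).2 = 0 := by
    have := congrFun ((E.triv i).coe_linearMapAt_of_mem (R := ℂ) hb) 0
    rw [map_zero] at this
    exact this.symm
  rw [h] at h0
  exact h0

/-- The Gauss map read through `e_i⁻¹`: `(b, z) ↦ g (e_i⁻¹(b) z)` is continuous on `U_i × F`. [folklore] -/
theorem continuousOn_gauss_triv_symm (i : B) :
    ContinuousOn (fun q : B × E.F ↦ g.toFun ⟨q.1, (E.triv i).symm q.1 q.2⟩)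
      ((E.triv i).baseSet ×ˢ univ) :=
  g.continuous.comp_continuousOn (E.triv i).continuousOn_symm

/-- **Continuity of the projection coefficient in a chart**: `q ↦ s_α(m q)(e_i⁻¹(b) (x q))` is
continuous on `S` for `m : X → P(E)` continuous on `S` with values in the chart of `α` and
`x : X → F` continuous on `S`. [folklore] -/
theorem continuousOn_lineCoeff {X : Type*} [TopologicalSpace X] (α : E.FrameIndex) {m : X → E.Proj}
    {x : X → E.F} {S : Set X} (hm : ContinuousOn m S) (hx : ContinuousOn x S)
    (hS : MapsTo m S (E.chartSet k₀ α)) :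
    ContinuousOn (fun q ↦ E.lineCoeff k₀ g α (m q) ((E.triv α.1).symm (m q).proj (x q))) S := by
  have hN := continuousOn_gauss_triv_symm g α.1
  have hproj : ContinuousOn (fun q ↦ (m q).proj) S := (continuous_projProj ℂ E.F E.E).comp_continuousOn hm
  have hv : ContinuousOn (fun q ↦ α.2.symm (E.lineRep k₀ α (m q))) S :=
    α.2.symm.continuous.comp_continuousOn ((continuousOn_lineRep α).comp hm hS)
  -- `U q = g u_α(m q)` and `W q = g (e⁻¹ (x q))`
  have hU : ContinuousOn (fun q ↦
      g.toFun ⟨(m q).proj, (E.triv α.1).symm (m q).proj (α.2.symm (E.lineRep k₀ α (m q)))⟩) S :=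
    hN.comp (hproj.prodMk hv) fun q hq ↦ ⟨(hS hq).1, mem_univ _⟩
  have hW : ContinuousOn (fun q ↦ g.toFun ⟨(m q).proj, (E.triv α.1).symm (m q).proj (x q)⟩) S :=
    hN.comp (hproj.prodMk hx) fun q hq ↦ ⟨(hS hq).1, mem_univ _⟩
  have hU0 : ∀ q ∈ S,
      g.toFun ⟨(m q).proj, (E.triv α.1).symm (m q).proj (α.2.symm (E.lineRep k₀ α (m q)))⟩ ≠ 0 := by
    intro q hq h
    apply lineRep_ne_zero (hS hq)
    have h1 : (E.triv α.1).symm (m q).proj (α.2.symm (E.lineRep k₀ α (m q))) = 0 := by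
      by_contra hne
      exact g.apply_ne_zero hne h
    have h2 : α.2.symm (E.lineRep k₀ α (m q)) = 0 := triv_symm_eq_zero (hS hq).1 h1
    simpa using congrArg α.2 h2
  have heq : EqOn (fun q ↦ E.lineCoeff k₀ g α (m q) ((E.triv α.1).symm (m q).proj (x q)))
      (fun q ↦ (⟪g.toFun ⟨(m q).proj, (E.triv α.1).symm (m q).proj (α.2.symm (E.lineRep k₀ α (m q)))⟩,
          g.toFun ⟨(m q).proj, (E.triv α.1).symm (m q).proj (α.2.symm (E.lineRep k₀ α (m q)))⟩⟫_ℂ)⁻¹ *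
        ⟪g.toFun ⟨(m q).proj, (E.triv α.1).symm (m q).proj (α.2.symm (E.lineRep k₀ α (m q)))⟩,
          g.toFun ⟨(m q).proj, (E.triv α.1).symm (m q).proj (x q)⟩⟫_ℂ) S := by
    intro q hq
    simp only [lineCoeff_apply, gaussAt_apply, lineVecIn, adaptedFrame_symm_eq_triv_symm (hS hq).1]
  refine ContinuousOn.congr ?_ heq
  exact ((hU.inner hU).inv₀ fun q hq ↦ inner_self_ne_zero.2 (hU0 q hq)).mul (hU.inner hW)

/-- The adapted chart at `m` uses the canonical trivialisation at `q m`. [folklore] -/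
theorem chartAt_fst (m : E.Proj) : (E.chartAt k₀ m).1 = m.proj := rfl

/-- `adaptedFrame_symm_triv` for the adapted chart at `m₀` (stated with `e_{q m₀}`). [folklore] -/
theorem adaptedFrame_chartAt_triv_symm (m₀ : E.Proj) {b : B} (hb : b ∈ (E.triv m₀.proj).baseSet)
    (x : E.F) : E.adaptedFrame (E.chartAt k₀ m₀) b ((E.triv m₀.proj).symm b x) = (E.chartAt k₀ m₀).2 x :=
  adaptedFrame_symm_triv (α := E.chartAt k₀ m₀) hb x

/-- `adaptedFrame_symm_eq_triv_symm` for the adapted chart at `m₀`. [folklore] -/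
theorem adaptedFrame_chartAt_symm (m₀ : E.Proj) {b : B} (hb : b ∈ (E.triv m₀.proj).baseSet) (z : E.F) :
    (E.adaptedFrame (E.chartAt k₀ m₀) b).symm z = (E.triv m₀.proj).symm b ((E.chartAt k₀ m₀).2.symm z) :=
  adaptedFrame_symm_eq_triv_symm (α := E.chartAt k₀ m₀) hb z

/-- `continuousOn_lineCoeff` for the adapted chart at `m₀` (stated with `e_{q m₀}`). [folklore] -/
theorem continuousOn_lineCoeff_chartAt {X : Type*} [TopologicalSpace X] (m₀ : E.Proj) {m : X → E.Proj}
    {x : X → E.F} {S : Set X} (hm : ContinuousOn m S) (hx : ContinuousOn x S)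
    (hS : MapsTo m S (E.chartSet k₀ (E.chartAt k₀ m₀))) :
    ContinuousOn (fun q ↦ E.lineCoeff k₀ g (E.chartAt k₀ m₀) (m q)
      ((E.triv m₀.proj).symm (m q).proj (x q))) S :=
  continuousOn_lineCoeff g (E.chartAt k₀ m₀) hm hx hS

/-- **The forward map is continuous in charts**: read through the pull-back trivialisation of
`q*E` at `m₀` and the product trivialisation of `λ ⊕ σ` at `m₀`, the splitting map is
`(m, x) ↦ (s_{α₀}(m)(e⁻¹ x), A₀ x - φ₀(A₀ x) v_{α₀}(m))` near `(m₀, x₀)` (`α₀ = (q m₀, A₀)` the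
adapted chart at `m₀`), which is continuous. [cite: HusemollerFibreBundles1994, Ch. 17 §5 Prop. 5.2] -/
theorem continuousAt_splitFwd_chart (m₀ : E.Proj) (x₀ : E.F) :
    ContinuousAt (fun q : E.Proj × E.F ↦
      ((E.lineCore k₀).coordChange (E.chartAt k₀ q.1) (E.chartAt k₀ m₀) q.1
          (E.splitFwd k₀ g (E.chartAt k₀ q.1) q.1 ((E.triv m₀.proj).symm q.1.proj q.2)).1,
        (E.quotCore k₀).coordChange (E.chartAt k₀ q.1) (E.chartAt k₀ m₀) q.1
          (E.splitFwd k₀ g (E.chartAt k₀ q.1) q.1 ((E.triv m₀.proj).symm q.1.proj q.2)).2))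
      (m₀, x₀) := by
  have hS : E.chartSet k₀ (E.chartAt k₀ m₀) ×ˢ (univ : Set E.F) ∈ 𝓝 (m₀, x₀) :=
    prod_mem_nhds ((isOpen_chartSet _).mem_nhds (E.mem_chartSet_chartAt k₀ m₀)) univ_mem
  -- the local expression
  have h1 : ContinuousOn (fun q : E.Proj × E.F ↦
      E.lineCoeff k₀ g (E.chartAt k₀ m₀) q.1 ((E.triv m₀.proj).symm q.1.proj q.2))
      (E.chartSet k₀ (E.chartAt k₀ m₀) ×ˢ univ) :=
    continuousOn_lineCoeff_chartAt (k₀ := k₀) g m₀ continuousOn_fst continuousOn_snd fun q hq ↦ hq.1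
  have h2 : ContinuousOn (fun q : E.Proj × E.F ↦
      E.projAlong k₀ (E.lineRep k₀ (E.chartAt k₀ m₀) q.1) ((E.chartAt k₀ m₀).2 q.2))
      (E.chartSet k₀ (E.chartAt k₀ m₀) ×ˢ univ) := by
    have ha : ContinuousOn (fun q : E.Proj × E.F ↦ E.projAlong k₀ (E.lineRep k₀ (E.chartAt k₀ m₀) q.1))
        (E.chartSet k₀ (E.chartAt k₀ m₀) ×ˢ univ) :=
      (E.continuous_projAlong k₀).comp_continuousOn
        ((continuousOn_lineRep _).comp continuousOn_fst fun q hq ↦ hq.1)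
    have hb : Continuous fun q : E.Proj × E.F ↦ (E.chartAt k₀ m₀).2 q.2 :=
      (E.chartAt k₀ m₀).2.continuous.comp continuous_snd
    exact ha.clm_apply hb.continuousOn
  refine ((h1.prodMk h2).continuousAt hS).congr_of_eventuallyEq ?_
  filter_upwards [hS] with q hq
  have hb : q.1.proj ∈ (E.triv m₀.proj).baseSet := hq.1.1
  rw [coordChange_splitFwd g (E.mem_chartSet_chartAt k₀ q.1) hq.1, splitFwd_apply]
  refine Prod.ext rfl ?_
  change E.projAlong k₀ (E.lineRep k₀ (E.chartAt k₀ m₀) q.1)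
    (E.adaptedFrame (E.chartAt k₀ m₀) q.1.proj ((E.triv m₀.proj).symm q.1.proj q.2)) = _
  rw [adaptedFrame_chartAt_triv_symm m₀ hb]

/-- **The backward map is continuous in charts**: read through the product trivialisation of
`λ ⊕ σ` at `m₀` and the trivialisation of `E` at `q m₀`, it is
`(m, c, y) ↦ A₀⁻¹ ((c - s_{α₀}(m)(T⁻¹ y)) v_{α₀}(m) + y)` near `(m₀, z₀)`, which is continuous.
[cite: HusemollerFibreBundles1994, Ch. 17 §5 Prop. 5.2] -/
theorem continuousAt_splitBwd_chart (m₀ : E.Proj) (z₀ : ℂ × E.quotModel k₀) :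
    ContinuousAt (fun q : E.Proj × (ℂ × E.quotModel k₀) ↦
      ((E.triv m₀.proj) ⟨q.1.proj, E.splitBwd k₀ g (E.chartAt k₀ q.1) q.1
        (((E.lineCore k₀).localTrivAt m₀).symm q.1 q.2.1,
          ((E.quotCore k₀).localTrivAt m₀).symm q.1 q.2.2)⟩).2) (m₀, z₀) := by
  have hS : E.chartSet k₀ (E.chartAt k₀ m₀) ×ˢ (univ : Set (ℂ × E.quotModel k₀)) ∈ 𝓝 (m₀, z₀) :=
    prod_mem_nhds ((isOpen_chartSet _).mem_nhds (E.mem_chartSet_chartAt k₀ m₀)) univ_mem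
  -- the ingredients of the local expression
  have hc : Continuous fun q : E.Proj × (ℂ × E.quotModel k₀) ↦ q.2.1 :=
    continuous_fst.comp continuous_snd
  have hy : Continuous fun q : E.Proj × (ℂ × E.quotModel k₀) ↦ (q.2.2 : E.F) :=
    (E.quotModel k₀).subtypeL.continuous.comp (continuous_snd.comp continuous_snd)
  have hv : ContinuousOn (fun q : E.Proj × (ℂ × E.quotModel k₀) ↦ E.lineRep k₀ (E.chartAt k₀ m₀) q.1)
      (E.chartSet k₀ (E.chartAt k₀ m₀) ×ˢ univ) :=
    (continuousOn_lineRep _).comp continuousOn_fst fun q hq ↦ hq.1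
  have hs : ContinuousOn (fun q : E.Proj × (ℂ × E.quotModel k₀) ↦
      E.lineCoeff k₀ g (E.chartAt k₀ m₀) q.1
        ((E.triv m₀.proj).symm q.1.proj ((E.chartAt k₀ m₀).2.symm (q.2.2 : E.F))))
      (E.chartSet k₀ (E.chartAt k₀ m₀) ×ˢ univ) := by
    have hA : Continuous fun q : E.Proj × (ℂ × E.quotModel k₀) ↦ (E.chartAt k₀ m₀).2.symm (q.2.2 : E.F) :=
      (E.chartAt k₀ m₀).2.symm.continuous.comp hy
    exact continuousOn_lineCoeff_chartAt (k₀ := k₀) g m₀ continuousOn_fst hA.continuousOn fun q hq ↦ hq.1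
  have hX : ContinuousOn (fun q : E.Proj × (ℂ × E.quotModel k₀) ↦
      (q.2.1 - E.lineCoeff k₀ g (E.chartAt k₀ m₀) q.1
        ((E.triv m₀.proj).symm q.1.proj ((E.chartAt k₀ m₀).2.symm (q.2.2 : E.F)))) •
          E.lineRep k₀ (E.chartAt k₀ m₀) q.1 + (q.2.2 : E.F))
      (E.chartSet k₀ (E.chartAt k₀ m₀) ×ˢ univ) :=
    ((hc.continuousOn.sub hs).smul hv).add hy.continuousOn
  have hG : ContinuousOn (fun q : E.Proj × (ℂ × E.quotModel k₀) ↦ (E.chartAt k₀ m₀).2.symm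
      ((q.2.1 - E.lineCoeff k₀ g (E.chartAt k₀ m₀) q.1
        ((E.triv m₀.proj).symm q.1.proj ((E.chartAt k₀ m₀).2.symm (q.2.2 : E.F)))) •
          E.lineRep k₀ (E.chartAt k₀ m₀) q.1 + (q.2.2 : E.F)))
      (E.chartSet k₀ (E.chartAt k₀ m₀) ×ˢ univ) :=
    (E.chartAt k₀ m₀).2.symm.continuous.comp_continuousOn hX
  refine (hG.continuousAt hS).congr_of_eventuallyEq ?_
  filter_upwards [hS] with q hq
  have hb : q.1.proj ∈ (E.triv m₀.proj).baseSet := hq.1.1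
  have hl : ((E.lineCore k₀).localTrivAt m₀).symm q.1 q.2.1 =
      (E.lineCore k₀).coordChange (E.chartAt k₀ m₀) (E.chartAt k₀ q.1) q.1 q.2.1 :=
    (E.lineCore k₀).localTriv_symm_apply (E.chartAt k₀ m₀) hq.1 q.2.1
  have hl' : ((E.quotCore k₀).localTrivAt m₀).symm q.1 q.2.2 =
      (E.quotCore k₀).coordChange (E.chartAt k₀ m₀) (E.chartAt k₀ q.1) q.1 q.2.2 :=
    (E.quotCore k₀).localTriv_symm_apply (E.chartAt k₀ m₀) hq.1 q.2.2
  change ((E.triv m₀.proj) ⟨q.1.proj, E.splitBwd k₀ g (E.chartAt k₀ q.1) q.1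
    (((E.lineCore k₀).localTrivAt m₀).symm q.1 q.2.1,
      ((E.quotCore k₀).localTrivAt m₀).symm q.1 q.2.2)⟩).2 = _
  rw [hl, hl', splitBwd_coordChange g hq.1 (E.mem_chartSet_chartAt k₀ q.1), splitBwd_apply,
    adaptedFrame_chartAt_symm m₀ hb, adaptedFrame_chartAt_symm m₀ hb]
  exact congrArg Prod.snd ((E.triv m₀.proj).apply_mk_symm hb _)

/-! ### The isomorphism and the splitting data -/

/-- The forward map of total spaces is continuous. [cite: HusemollerFibreBundles1994, Ch. 17 §5 Prop. 5.2] -/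
theorem continuous_splitFwd_totalSpace :
    Continuous fun p : TotalSpace (E.pullback E.projMap).F (E.pullback E.projMap).E ↦
      (⟨p.proj, splitEquiv g (E.mem_chartSet_chartAt k₀ p.proj) p.2⟩ :
        TotalSpace ((E.lineBundle k₀).directSum (E.quotBundle k₀)).F
          ((E.lineBundle k₀).directSum (E.quotBundle k₀)).E) := by
  refine continuous_totalSpace_map (F₁ := (E.pullback E.projMap).F)
    (F₂ := ((E.lineBundle k₀).directSum (E.quotBundle k₀)).F)
    (E₁ := (E.pullback E.projMap).E) (E₂ := ((E.lineBundle k₀).directSum (E.quotBundle k₀)).E)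
    (g := id) continuous_id
    (fun m (w : (E.pullback E.projMap).E m) ↦ (splitEquiv g (E.mem_chartSet_chartAt k₀ m) w :
      ((E.lineBundle k₀).directSum (E.quotBundle k₀)).E m)) fun p ↦ ?_
  obtain ⟨m₀, w₀⟩ := p
  exact continuousAt_splitFwd_chart g m₀ _

/-- The backward map of total spaces, followed by the lift to `E`, is continuous. [cite: HusemollerFibreBundles1994, Ch. 17 §5 Prop. 5.2] -/
theorem continuous_splitBwd_totalSpace :
    Continuous fun p : TotalSpace ((E.lineBundle k₀).directSum (E.quotBundle k₀)).F
        ((E.lineBundle k₀).directSum (E.quotBundle k₀)).E ↦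
      (⟨p.proj.proj, (splitEquiv g (E.mem_chartSet_chartAt k₀ p.proj)).symm p.2⟩ : TotalSpace E.F E.E) := by
  refine continuous_totalSpace_map (F₁ := ((E.lineBundle k₀).directSum (E.quotBundle k₀)).F)
    (F₂ := E.F) (E₁ := ((E.lineBundle k₀).directSum (E.quotBundle k₀)).E) (E₂ := E.E)
    (g := (TotalSpace.proj : E.Proj → B)) (continuous_projProj ℂ E.F E.E)
    (fun m (z : ((E.lineBundle k₀).directSum (E.quotBundle k₀)).E m) ↦
      (splitEquiv g (E.mem_chartSet_chartAt k₀ m)).symm z) fun p ↦ ?_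
  obtain ⟨m₀, z₀⟩ := p
  exact continuousAt_splitBwd_chart g m₀ _

variable (E k₀)

/-- **Husemoller's splitting `q*ξ ≅ λ_ξ ⊕ σ_ξ` over the projective bundle** as an isomorphism of
the tree's complex vector bundles over `P(E)`, for the metric induced by the Gauss map `g`.
[cite: HusemollerFibreBundles1994, Ch. 17 §5 Prop. 5.2] -/
def splitIso : (E.pullback E.projMap).Iso ((E.lineBundle k₀).directSum (E.quotBundle k₀)) where
  equiv m := splitEquiv g (E.mem_chartSet_chartAt k₀ m)
  continuous_toFun := continuous_splitFwd_totalSpace g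
  continuous_invFun := by
    refine (inducing_pullbackTotalSpaceEmbedding E.F E.E E.projMap).continuous_iff.2 ?_
    exact (FiberBundle.continuous_proj ((E.lineBundle k₀).directSum (E.quotBundle k₀)).F
      ((E.lineBundle k₀).directSum (E.quotBundle k₀)).E).prodMk (continuous_splitBwd_totalSpace g)

/-- `P(E)` is paracompact when `B` is (compact fibre `ℙ F`, `paracompactSpace_totalSpace`).
[cite: HusemollerFibreBundles1994, Ch. 17 (2.4)] -/
instance instParacompactSpaceProj [ParacompactSpace B] : ParacompactSpace E.Proj := by
  haveI : CompactSpace (ℙ ℂ E.F) := compactSpace_of_finiteDimensional ℂ E.F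
  exact paracompactSpace_totalSpace (ℙ ℂ E.F)

/-- **Existence of the splitting data over a paracompact Hausdorff base** (the point-set half of
Husemoller Ch. 17 Prop. 5.2): for `rank E ≥ 1` there are a paracompact Hausdorff `B₁` (namely
`P(E)`), `f : B₁ → B` (namely `q`), a line bundle `L` and a bundle `E'` of rank `rank E - 1` over
`B₁` with `f*E ≅ L ⊕ E'`. [cite: HusemollerFibreBundles1994, Ch. 17 §5 Prop. 5.2] -/
theorem exists_splitting [T2Space B] [ParacompactSpace B] (hE : 1 ≤ E.rank) :
    ∃ (B₁ : Type) (_ : TopologicalSpace B₁) (_ : T2Space B₁) (_ : ParacompactSpace B₁)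
      (f : C(B₁, B)) (L E' : ComplexVectorBundle.{0, 0} B₁),
      L.rank = 1 ∧ E'.rank + 1 = E.rank ∧ Nonempty ((E.pullback f).Iso (L.directSum E')) := by
  obtain ⟨g⟩ := exists_gaussMap (𝕜 := ℂ) (F := E.F) (E := E.E)
    (id : B × Fin (Module.finrank ℂ E.F) → B × Fin (Module.finrank ℂ E.F)) injective_id
  let k₀ : Fin E.rank := ⟨0, hE⟩
  refine ⟨E.Proj, inferInstance, inferInstance, inferInstance, E.projMap, E.lineBundle k₀,
    E.quotBundle k₀, E.rank_lineBundle k₀, ?_, ⟨E.splitIso k₀ g⟩⟩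
  rw [rank_quotBundle]
  omega

end ComplexVectorBundle

end Literature.AlgebraicTopology.CharacteristicClasses
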